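import Mathlib
import HarnessLib
import Summits.HubbardSuperconductivity.HubbardSuperconductivity.Theorems.KLProgrammeC4aKeyLemmaCooperBase
import Summits.HubbardSuperconductivity.HubbardSuperconductivity.Theorems.KLProgrammeC4aBandDistanceControl
import Summits.HubbardSuperconductivity.HubbardSuperconductivity.Theorems.KLProgrammeC4aPartnerBandTangencyDefectThree

/-!
# Route `KLProgramme` — crux C4a, S3 brick (B4) «(U1)-HYBRID» part D-3c (iv): THE KEY LEMMA NEAR COOPER, ONE CALL — `|𝒜_φ| ≤ Q·|ē| + C·(|e| + |ρ|)` on the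
# WHOLE loop circle for every configuration of the Cooper window `‖ϑ − π‖_𝕋 ≤ η₀`, with `Q`, `C` free of `η` and of the scale

Cell `gate-hubbard-kl`, seat hubbard-kl-k3c3-p3 (g37; row «implicit-function / monotonicity route for μ(n)»).  Located brick for the (C)-closer lane / the (M4)
assembly of the first-order ϑ-layer (stub (C) `stub_twoLeg_curvature` of `KLRegimeEngineV17F2`, stmt-HubbardSuperconductivity-20437), memo
HOME/hubbard-kl-k3c3-p3/U1-CAUSTIC-SUP.md §19 addendum (c) «D-3».  The Cooper twin of `…C4aKeyLemmaTangency` (D-2a): there the mechanism at `e = ρ = 0` is the two-node /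
convexity control on the two-node window; here it is the η-scaled RATIO control of `…C4aKeyLemmaCooperBase` on the whole loop circle; the transport to the loop
level `e` and the offset `ρ` is the same (level row `…C4aBandDistanceControl.abs_iteratedDeriv_partnerBand_pp_base_sub_level_le`, offset row
`…C4aPartnerBandOffsetRow.abs_iteratedDeriv_partnerBand_pp_base_sub_offset_le`, radial rows `radialRows_le_three`).
* `abs_baseDeriv_partnerBand_pp_le_of_ratio_displacement` — bookkeeping: a ratio control `|h(0,·;0)| ≤ q|f(0,·;0)|` plus the level/offset rows at orders `0, 1` give
  `|h(e,φ;ρ)| ≤ q|f(e,φ;ρ)| + (q𝒦Rᵉ + 2𝒦RᵉDₑ)|e| + (q𝒦Rᵖ + 2𝒦RᵖDᵨ)|ρ|`;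
* **`abs_baseDeriv_partnerBand_pp_le_band_distance_cooper`** (HEADLINE): under clause (i) `GeomConstants` of `FrameOK` and the threshold rows of
  `…C4aKeyLemmaCooperBase`, for `‖ϑ − π‖_𝕋 ≤ η₀`, `|e|, |ρ| < r` and EVERY loop angle `v`:
  `|∂_ψ|_θ e_K(Φ(0,ψ) + Φ(ρ,ϑ+ψ) − Φ(e,v+ψ))| ≤ Q·|e_K(S − Φ(e,v+θ))| + (Q𝒦Re + 2𝒦ReDe)·|e| + (Q𝒦Re + 2𝒦ReDe)·|ρ|`,
  `Q = max(H₁₀/(G/2), H₀₀/(Gδ₀/4))`, `𝒦 = max K₁ K₂`, `Re = max (1/d) RR₁`, `De = max 1 (3msD₁ + r·RR₁)` — the `hkey` row of `…C4aUmkDirectLevelLine.directPart_levelLine_abs_le`.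
Sizes binder shape; pure bookkeeping on landed objects; nothing asserts (C), K3 or superconductivity.
References: FST II CPAM 51 (1998) §3 Thm 3.5 [cite: FeldmanSalmhoferTrubowitz1998]; BGM 2006 §2.4 Lemma 2.1 (2.40) [cite: BenfattoGiulianiMastropietro2006].
-/

noncomputable section

namespace Summit.HubbardSuperconductivity.HubbardSuperconductivity.Theorems.C4a

set_option linter.dupNamespace false -- summit = problem name (single-conjunct summit), D-0017

open Real Set Filter
open scoped Topology
open Literature.MathematicalPhysics.QuantumLattice Literature.MathematicalPhysics.QuantumLattice.BandSectorCounting Literature.Probability.LatticeModels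
open Literature.MathematicalPhysics.QuantumLattice.FermiRG
open Summit.HubbardSuperconductivity.HubbardSuperconductivity.Theorems.KLRegimeSplit
open Summit.HubbardSuperconductivity.HubbardSuperconductivity.Theorems.DispersionFlow
open Summit.HubbardSuperconductivity.HubbardSuperconductivity.Theorems.PerturbedFermiCurve

section Sizes

variable {K : TrigPolyC4v} {A : ℝ} (hA : ∀ p : Momentum, ∀ j ≤ 2, ‖iteratedFDeriv ℝ j (frameShift K) p‖ ≤ A) (hA20 : A ≤ 1 / 20)
  (hd : klCurveD ≤ (bandBounds (show (-4 : ℝ) < -1.1 by norm_num) (show (-1.1 : ℝ) ≤ -0.1 by norm_num)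
    (show (-0.1 : ℝ) < 0 by norm_num)).Dtmin - 2 * A)
  {μ r : ℝ} (hr : 0 < r) (hlo : (-1.1 : ℝ) < μ - r - A) (hhi : μ + r + A < -0.1)
  {A₃ A₄ A₅ A₆ : ℝ} (hA₃ : ∀ p : Momentum, ‖iteratedFDeriv ℝ 3 (frameShift K) p‖ ≤ A₃)
  (hA₄ : ∀ p : Momentum, ‖iteratedFDeriv ℝ 4 (frameShift K) p‖ ≤ A₄)
  (hA₅ : ∀ p : Momentum, ‖iteratedFDeriv ℝ 5 (frameShift K) p‖ ≤ A₅)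
  (hA₆ : ∀ p : Momentum, ‖iteratedFDeriv ℝ 6 (frameShift K) p‖ ≤ A₆)
  {K₁ K₂ K₃ : ℝ} (hK₁ : ∀ p : Momentum, ‖fderiv ℝ (frameLevel μ K) p‖ ≤ K₁) (hK₂ : ∀ p : Momentum, ‖iteratedFDeriv ℝ 2 (frameLevel μ K) p‖ ≤ K₂)
  (hK₃ : ∀ p : Momentum, ‖iteratedFDeriv ℝ 3 (frameLevel μ K) p‖ ≤ K₃)
include hA hA20 hd hr hlo hhi hA₃ hA₄ hA₅ hA₆ hK₁ hK₂ hK₃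

omit hK₁ hK₂ hK₃ in
/-- **Displacement bookkeeping for a ratio control** (order `1`): if at `e = ρ = 0` `|∂_ψ|_θ ē(0,φ;0,ϑ)| ≤ q·|ē(0,φ;0,ϑ,θ)|` for every `φ`, then with the level / offset
rows at orders `0, 1` (radial rows `RRᵉ, RRᵖ`, packaging `Dₑ, Rᵉ, Dᵨ, Rᵖ` as in `…C4aBandDistanceControl`),
`|∂_ψ|_θ ē(e,φ;ρ,ϑ)| ≤ q·|ē(e,φ;ρ,ϑ,θ)| + (q𝒦Rᵉ + 2𝒦RᵉDₑ)|e| + (q𝒦Rᵖ + 2𝒦RᵖDᵨ)|ρ|`. -/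
theorem abs_baseDeriv_partnerBand_pp_le_of_ratio_displacement (ϑ θ : ℝ) {q : ℝ} (hq : 0 ≤ q)
    (hctrl : ∀ φ : ℝ, |deriv (fun ψ : ℝ => frameLevel μ K (levelPoint μ K 0 ψ + levelPoint μ K 0 (ϑ + ψ) - levelPoint μ K 0 (φ + ψ))) θ| ≤
      q * |frameLevel μ K (levelPoint μ K 0 θ + levelPoint μ K 0 (ϑ + θ) - levelPoint μ K 0 (φ + θ))|)
    {𝒦 : ℝ} (hK : ∀ i, 1 ≤ i → i ≤ 1 + 1 → ∀ p : Momentum, ‖iteratedFDeriv ℝ i (frameLevel μ K) p‖ ≤ 𝒦)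
    {ρ : ℝ} (hρ : |ρ| < r) {e : ℝ} (he : |e| < r) {RRe RRp : ℕ → ℝ}
    (hRRe : ∀ i, i ≤ 1 → ∀ s, ‖iteratedDeriv i (levelPoint μ K e) s - iteratedDeriv i (levelPoint μ K 0) s‖ ≤ RRe i * |e|)
    (hRRp : ∀ i, i ≤ 1 → ∀ s, ‖iteratedDeriv i (levelPoint μ K ρ) s - iteratedDeriv i (levelPoint μ K 0) s‖ ≤ RRp i * |ρ|)
    {De Re Dp Rp : ℝ} (hDe : 0 ≤ De) (hRe : 0 ≤ Re) (hDp : 0 ≤ Dp) (hRp : 0 ≤ Rp)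
    (hDerow : ∀ j, 1 ≤ j → j ≤ 1 → 3 * msD6 A₃ A₄ A₅ A₆ j + |e| * RRe j ≤ De ^ j) (hRerow : ∀ j, j ≤ 1 → RRe j ≤ Re * De ^ j)
    (hDprow : ∀ j, 1 ≤ j → j ≤ 1 → 3 * msD6 A₃ A₄ A₅ A₆ j + |ρ| * RRp j ≤ Dp ^ j) (hRprow : ∀ j, j ≤ 1 → RRp j ≤ Rp * Dp ^ j) (φ : ℝ) :
    |deriv (fun ψ : ℝ => frameLevel μ K (levelPoint μ K 0 ψ + levelPoint μ K ρ (ϑ + ψ) - levelPoint μ K e (φ + ψ))) θ| ≤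
      q * |frameLevel μ K (levelPoint μ K 0 θ + levelPoint μ K ρ (ϑ + θ) - levelPoint μ K e (φ + θ))| +
        (q * (𝒦 * Re) + 2 * 𝒦 * Re * De) * |e| + (q * (𝒦 * Rp) + 2 * 𝒦 * Rp * Dp) * |ρ| := by
  have h0 : |(0 : ℝ)| < r := by simpa using hr
  have h2 := hctrl φ
  have h2fac : (((1 + 1).factorial : ℕ) : ℝ) = 2 := by norm_num [Nat.factorial]
  have hK0 : ∀ i, 1 ≤ i → i ≤ 0 + 1 → ∀ p : Momentum, ‖iteratedFDeriv ℝ i (frameLevel μ K) p‖ ≤ 𝒦 := fun i hi1 hi p => hK i hi1 (by omega) p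
  have hem := abs_iteratedDeriv_partnerBand_pp_base_sub_level_le hA hA20 hd hr hlo hhi hA₃ hA₄ hA₅ hA₆ (k := 1) (by norm_num) hK h0 he hRRe hDe hRe hDerow
    hRerow ϑ θ φ
  have he0 := abs_iteratedDeriv_partnerBand_pp_base_sub_level_le hA hA20 hd hr hlo hhi hA₃ hA₄ hA₅ hA₆ (k := 0) (by norm_num) hK0 h0 he
    (RR := RRe) (fun i hi s => hRRe i (by omega) s) hDe hRe (fun j hj1 hj => by omega) (fun j hj => hRerow j (by omega)) ϑ θ φ
  have hpm := abs_iteratedDeriv_partnerBand_pp_base_sub_offset_le hA hA20 hd hr hlo hhi hA₃ hA₄ hA₅ hA₆ (k := 1) (by norm_num) hK hρ he hRRp hDp hRp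
    hDprow hRprow ϑ θ φ
  have hp0 := abs_iteratedDeriv_partnerBand_pp_base_sub_offset_le hA hA20 hd hr hlo hhi hA₃ hA₄ hA₅ hA₆ (k := 0) (by norm_num) hK0 hρ he
    (RR := RRp) (fun i hi s => hRRp i (by omega) s) hDp hRp (fun j hj1 hj => by omega) (fun j hj => hRprow j (by omega)) ϑ θ φ
  simp only [iteratedDeriv_zero, Nat.factorial, Nat.cast_one, pow_zero, mul_one] at he0 hp0
  simp only [iteratedDeriv_one, h2fac, pow_one] at hem hpm
  have habs1 := abs_sub_abs_le_abs_sub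
    (deriv (fun ψ : ℝ => frameLevel μ K (levelPoint μ K 0 ψ + levelPoint μ K ρ (ϑ + ψ) - levelPoint μ K e (φ + ψ))) θ)
    (deriv (fun ψ : ℝ => frameLevel μ K (levelPoint μ K 0 ψ + levelPoint μ K 0 (ϑ + ψ) - levelPoint μ K e (φ + ψ))) θ)
  have habs2 := abs_sub_abs_le_abs_sub
    (deriv (fun ψ : ℝ => frameLevel μ K (levelPoint μ K 0 ψ + levelPoint μ K 0 (ϑ + ψ) - levelPoint μ K e (φ + ψ))) θ)
    (deriv (fun ψ : ℝ => frameLevel μ K (levelPoint μ K 0 ψ + levelPoint μ K 0 (ϑ + ψ) - levelPoint μ K 0 (φ + ψ))) θ)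
  have habs3 := abs_sub_abs_le_abs_sub
    (frameLevel μ K (levelPoint μ K 0 θ + levelPoint μ K 0 (ϑ + θ) - levelPoint μ K 0 (φ + θ)))
    (frameLevel μ K (levelPoint μ K 0 θ + levelPoint μ K 0 (ϑ + θ) - levelPoint μ K e (φ + θ)))
  have habs4 := abs_sub_abs_le_abs_sub
    (frameLevel μ K (levelPoint μ K 0 θ + levelPoint μ K 0 (ϑ + θ) - levelPoint μ K e (φ + θ)))
    (frameLevel μ K (levelPoint μ K 0 θ + levelPoint μ K ρ (ϑ + θ) - levelPoint μ K e (φ + θ)))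
  rw [abs_sub_comm] at habs3 habs4
  nlinarith [mul_le_mul_of_nonneg_left (le_trans habs3 he0) hq, mul_le_mul_of_nonneg_left (le_trans habs4 hp0) hq,
    abs_nonneg e, abs_nonneg ρ, mul_nonneg hq (abs_nonneg e), mul_nonneg hq (abs_nonneg ρ)]

/-- **THE KEY LEMMA NEAR COOPER, ONE CALL** (HEADLINE; see the module docstring).  With `d = Dt_min − 2A`, `RR₁ = radialRowOneConst A d`, `𝒦 = max K₁ K₂`,
`Re = max (1/d) RR₁`, `De = max 1 (3msD₁ + r·RR₁)`, `G = (2/π)·d·u_min·(u_min w/(4+2A))`, `Q = max(H₁₀/(G/2), H₀₀/(Gδ₀/4))`: for `‖ϑ − π‖_𝕋 ≤ η₀`, `|ρ|, |e| < r`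
and every loop angle `v`,
`|∂_ψ|_θ e_K(Φ(0,ψ) + Φ(ρ,ϑ+ψ) − Φ(e,v+ψ))| ≤ Q·|e_K(S − Φ(e,v+θ))| + (Q𝒦Re + 2𝒦ReDe)·|e| + (Q𝒦Re + 2𝒦ReDe)·|ρ|`. [cite: BenfattoGiulianiMastropietro2006, §2.4 Lemma 2.1] -/
theorem abs_baseDeriv_partnerBand_pp_le_band_distance_cooper {Kc r₀ g₀ w : ℝ} (hG : GeomConstants (frameLevel μ K) Kc r₀ g₀ w) {δ₀ η₀ : ℝ}
    (hδ₀ : 0 < δ₀) (hδ₀π : δ₀ ≤ π / 2)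
    (hδrow : (K₃ * msD A₃ A₄ 1 ^ 2 + K₂ * msD A₃ A₄ 2) * msD A₃ A₄ 1 * δ₀ ≤
      (2 / π * (((bandBounds (show (-4 : ℝ) < -1.1 by norm_num) (show (-1.1 : ℝ) ≤ -0.1 by norm_num) (show (-0.1 : ℝ) < 0 by norm_num)).Dtmin - 2 * A) *
        (bandBounds (show (-4 : ℝ) < -1.1 by norm_num) (show (-1.1 : ℝ) ≤ -0.1 by norm_num) (show (-0.1 : ℝ) < 0 by norm_num)).umin) *
        ((bandBounds (show (-4 : ℝ) < -1.1 by norm_num) (show (-1.1 : ℝ) ≤ -0.1 by norm_num) (show (-0.1 : ℝ) < 0 by norm_num)).umin * w / (4 + 2 * A))) / 2)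
    (hη₀ : η₀ ≤ δ₀ / 2)
    (hη₀row : (K₁ * msD A₃ A₄ 2 + K₂ * msD A₃ A₄ 1 ^ 2) * η₀ ≤
      (2 / π * (((bandBounds (show (-4 : ℝ) < -1.1 by norm_num) (show (-1.1 : ℝ) ≤ -0.1 by norm_num) (show (-0.1 : ℝ) < 0 by norm_num)).Dtmin - 2 * A) *
        (bandBounds (show (-4 : ℝ) < -1.1 by norm_num) (show (-1.1 : ℝ) ≤ -0.1 by norm_num) (show (-0.1 : ℝ) < 0 by norm_num)).umin) *
        ((bandBounds (show (-4 : ℝ) < -1.1 by norm_num) (show (-1.1 : ℝ) ≤ -0.1 by norm_num) (show (-0.1 : ℝ) < 0 by norm_num)).umin * w / (4 + 2 * A))) * δ₀ / 4)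
    {ϑ : ℝ} (hϑ : torusDist (ϑ - π) ≤ η₀) (θ : ℝ) {ρ e : ℝ} (hρ : |ρ| < r) (he : |e| < r) (v : ℝ) :
    |deriv (fun ψ : ℝ => frameLevel μ K (levelPoint μ K 0 ψ + levelPoint μ K ρ (ϑ + ψ) - levelPoint μ K e (v + ψ))) θ| ≤
      max ((K₂ * msD A₃ A₄ 1 * msD A₃ A₄ 2 + (K₃ * msD A₃ A₄ 1 ^ 2 + K₂ * msD A₃ A₄ 2) * msD A₃ A₄ 1) /
            ((2 / π * (((bandBounds (show (-4 : ℝ) < -1.1 by norm_num) (show (-1.1 : ℝ) ≤ -0.1 by norm_num) (show (-0.1 : ℝ) < 0 by norm_num)).Dtmin - 2 * A) *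
              (bandBounds (show (-4 : ℝ) < -1.1 by norm_num) (show (-1.1 : ℝ) ≤ -0.1 by norm_num) (show (-0.1 : ℝ) < 0 by norm_num)).umin) *
              ((bandBounds (show (-4 : ℝ) < -1.1 by norm_num) (show (-1.1 : ℝ) ≤ -0.1 by norm_num) (show (-0.1 : ℝ) < 0 by norm_num)).umin * w / (4 + 2 * A))) / 2))
          ((K₁ * msD A₃ A₄ 2 + K₂ * msD A₃ A₄ 1 * msD A₃ A₄ 1) /
            ((2 / π * (((bandBounds (show (-4 : ℝ) < -1.1 by norm_num) (show (-1.1 : ℝ) ≤ -0.1 by norm_num) (show (-0.1 : ℝ) < 0 by norm_num)).Dtmin - 2 * A) *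
              (bandBounds (show (-4 : ℝ) < -1.1 by norm_num) (show (-1.1 : ℝ) ≤ -0.1 by norm_num) (show (-0.1 : ℝ) < 0 by norm_num)).umin) *
              ((bandBounds (show (-4 : ℝ) < -1.1 by norm_num) (show (-1.1 : ℝ) ≤ -0.1 by norm_num) (show (-0.1 : ℝ) < 0 by norm_num)).umin * w / (4 + 2 * A))) * δ₀ / 4)) *
        |frameLevel μ K (pairSumPath μ K ρ ϑ θ 0 - levelPoint μ K e (v + θ))| +
      (max ((K₂ * msD A₃ A₄ 1 * msD A₃ A₄ 2 + (K₃ * msD A₃ A₄ 1 ^ 2 + K₂ * msD A₃ A₄ 2) * msD A₃ A₄ 1) /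
            ((2 / π * (((bandBounds (show (-4 : ℝ) < -1.1 by norm_num) (show (-1.1 : ℝ) ≤ -0.1 by norm_num) (show (-0.1 : ℝ) < 0 by norm_num)).Dtmin - 2 * A) *
              (bandBounds (show (-4 : ℝ) < -1.1 by norm_num) (show (-1.1 : ℝ) ≤ -0.1 by norm_num) (show (-0.1 : ℝ) < 0 by norm_num)).umin) *
              ((bandBounds (show (-4 : ℝ) < -1.1 by norm_num) (show (-1.1 : ℝ) ≤ -0.1 by norm_num) (show (-0.1 : ℝ) < 0 by norm_num)).umin * w / (4 + 2 * A))) / 2))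
          ((K₁ * msD A₃ A₄ 2 + K₂ * msD A₃ A₄ 1 * msD A₃ A₄ 1) /
            ((2 / π * (((bandBounds (show (-4 : ℝ) < -1.1 by norm_num) (show (-1.1 : ℝ) ≤ -0.1 by norm_num) (show (-0.1 : ℝ) < 0 by norm_num)).Dtmin - 2 * A) *
              (bandBounds (show (-4 : ℝ) < -1.1 by norm_num) (show (-1.1 : ℝ) ≤ -0.1 by norm_num) (show (-0.1 : ℝ) < 0 by norm_num)).umin) *
              ((bandBounds (show (-4 : ℝ) < -1.1 by norm_num) (show (-1.1 : ℝ) ≤ -0.1 by norm_num) (show (-0.1 : ℝ) < 0 by norm_num)).umin * w / (4 + 2 * A))) * δ₀ / 4)) *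
          ((max K₁ K₂) * max (1 / ((bandBounds (show (-4 : ℝ) < -1.1 by norm_num) (show (-1.1 : ℝ) ≤ -0.1 by norm_num) (show (-0.1 : ℝ) < 0 by norm_num)).Dtmin - 2 * A))
            (radialRowOneConst A ((bandBounds (show (-4 : ℝ) < -1.1 by norm_num) (show (-1.1 : ℝ) ≤ -0.1 by norm_num) (show (-0.1 : ℝ) < 0 by norm_num)).Dtmin - 2 * A))) +
        2 * (max K₁ K₂) *
          max (1 / ((bandBounds (show (-4 : ℝ) < -1.1 by norm_num) (show (-1.1 : ℝ) ≤ -0.1 by norm_num) (show (-0.1 : ℝ) < 0 by norm_num)).Dtmin - 2 * A))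
            (radialRowOneConst A ((bandBounds (show (-4 : ℝ) < -1.1 by norm_num) (show (-1.1 : ℝ) ≤ -0.1 by norm_num) (show (-0.1 : ℝ) < 0 by norm_num)).Dtmin - 2 * A)) *
          (max 1 (3 * msD A₃ A₄ 1 + r * radialRowOneConst A ((bandBounds (show (-4 : ℝ) < -1.1 by norm_num) (show (-1.1 : ℝ) ≤ -0.1 by norm_num)
            (show (-0.1 : ℝ) < 0 by norm_num)).Dtmin - 2 * A)))) * |e| +
      (max ((K₂ * msD A₃ A₄ 1 * msD A₃ A₄ 2 + (K₃ * msD A₃ A₄ 1 ^ 2 + K₂ * msD A₃ A₄ 2) * msD A₃ A₄ 1) /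
            ((2 / π * (((bandBounds (show (-4 : ℝ) < -1.1 by norm_num) (show (-1.1 : ℝ) ≤ -0.1 by norm_num) (show (-0.1 : ℝ) < 0 by norm_num)).Dtmin - 2 * A) *
              (bandBounds (show (-4 : ℝ) < -1.1 by norm_num) (show (-1.1 : ℝ) ≤ -0.1 by norm_num) (show (-0.1 : ℝ) < 0 by norm_num)).umin) *
              ((bandBounds (show (-4 : ℝ) < -1.1 by norm_num) (show (-1.1 : ℝ) ≤ -0.1 by norm_num) (show (-0.1 : ℝ) < 0 by norm_num)).umin * w / (4 + 2 * A))) / 2))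
          ((K₁ * msD A₃ A₄ 2 + K₂ * msD A₃ A₄ 1 * msD A₃ A₄ 1) /
            ((2 / π * (((bandBounds (show (-4 : ℝ) < -1.1 by norm_num) (show (-1.1 : ℝ) ≤ -0.1 by norm_num) (show (-0.1 : ℝ) < 0 by norm_num)).Dtmin - 2 * A) *
              (bandBounds (show (-4 : ℝ) < -1.1 by norm_num) (show (-1.1 : ℝ) ≤ -0.1 by norm_num) (show (-0.1 : ℝ) < 0 by norm_num)).umin) *
              ((bandBounds (show (-4 : ℝ) < -1.1 by norm_num) (show (-1.1 : ℝ) ≤ -0.1 by norm_num) (show (-0.1 : ℝ) < 0 by norm_num)).umin * w / (4 + 2 * A))) * δ₀ / 4)) *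
          ((max K₁ K₂) * max (1 / ((bandBounds (show (-4 : ℝ) < -1.1 by norm_num) (show (-1.1 : ℝ) ≤ -0.1 by norm_num) (show (-0.1 : ℝ) < 0 by norm_num)).Dtmin - 2 * A))
            (radialRowOneConst A ((bandBounds (show (-4 : ℝ) < -1.1 by norm_num) (show (-1.1 : ℝ) ≤ -0.1 by norm_num) (show (-0.1 : ℝ) < 0 by norm_num)).Dtmin - 2 * A))) +
        2 * (max K₁ K₂) *
          max (1 / ((bandBounds (show (-4 : ℝ) < -1.1 by norm_num) (show (-1.1 : ℝ) ≤ -0.1 by norm_num) (show (-0.1 : ℝ) < 0 by norm_num)).Dtmin - 2 * A))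
            (radialRowOneConst A ((bandBounds (show (-4 : ℝ) < -1.1 by norm_num) (show (-1.1 : ℝ) ≤ -0.1 by norm_num) (show (-0.1 : ℝ) < 0 by norm_num)).Dtmin - 2 * A)) *
          (max 1 (3 * msD A₃ A₄ 1 + r * radialRowOneConst A ((bandBounds (show (-4 : ℝ) < -1.1 by norm_num) (show (-1.1 : ℝ) ≤ -0.1 by norm_num)
            (show (-0.1 : ℝ) < 0 by norm_num)).Dtmin - 2 * A)))) * |ρ| := by
  set B := bandBounds (show (-4 : ℝ) < -1.1 by norm_num) (show (-1.1 : ℝ) ≤ -0.1 by norm_num) (show (-0.1 : ℝ) < 0 by norm_num) with hBdef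
  set G : ℝ := 2 / π * ((B.Dtmin - 2 * A) * B.umin) * (B.umin * w / (4 + 2 * A)) with hGdef
  set H₁₀ : ℝ := K₂ * msD A₃ A₄ 1 * msD A₃ A₄ 2 + (K₃ * msD A₃ A₄ 1 ^ 2 + K₂ * msD A₃ A₄ 2) * msD A₃ A₄ 1 with hH₁₀
  set H₀₀ : ℝ := K₁ * msD A₃ A₄ 2 + K₂ * msD A₃ A₄ 1 * msD A₃ A₄ 1 with hH₀₀
  have hπ := Real.pi_pos
  have h0 : |(0 : ℝ)| < r := by simpa using hr
  have hADt : 2 * A < B.Dtmin := by have := klCurveD_pos; linarith only [this, hd]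
  have hDt : 0 < B.Dtmin - 2 * A := by linarith only [hADt]
  have hA0 : 0 ≤ A := le_trans (norm_nonneg _) (hA 0 0 (by norm_num))
  have hGpos : 0 < G :=
    mul_pos (mul_pos (by positivity) (mul_pos hDt B.umin_pos)) (by have := B.umin_pos; have := hG.wmin_pos; positivity)
  have hK₁0 : 0 ≤ K₁ := (norm_nonneg _).trans (hK₁ 0)
  have hK₂0 : 0 ≤ K₂ := (norm_nonneg _).trans (hK₂ 0)
  have hK₃0 : 0 ≤ K₃ := (norm_nonneg _).trans (hK₃ 0)
  have hD1 : 0 ≤ msD A₃ A₄ 1 := (msD_one_pos A₃ A₄).le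
  have hD2 : 0 ≤ msD A₃ A₄ 2 := (norm_nonneg _).trans (norm_iteratedDeriv_levelPoint_le hA hA20 hd hlo hhi hA₃ hA₄ h0 (i := 2) (by norm_num) (by norm_num) 0)
  have hH₁₀0 : 0 ≤ H₁₀ := by positivity
  have hQ0 : 0 ≤ max (H₁₀ / (G / 2)) (H₀₀ / (G * δ₀ / 4)) := le_max_of_le_left (by positivity)
  set d := B.Dtmin - 2 * A with hddef
  set RR₁ := radialRowOneConst A d with hRR₁
  set 𝒦 : ℝ := max K₁ K₂ with h𝒦
  set Re : ℝ := max (1 / d) RR₁ with hRe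
  set De : ℝ := max 1 (3 * msD A₃ A₄ 1 + r * RR₁) with hDe
  have hRR₁0 : 0 ≤ RR₁ := radialRowOneConst_nonneg hA0 hDt
  have hRe0 : 0 ≤ Re := le_trans (by positivity) (le_max_left _ _)
  have hDe1 : 1 ≤ De := le_max_left _ _
  have hDe0 : 0 ≤ De := zero_le_one.trans hDe1
  -- §A periodic reduction of the pair angle to `|ϑ' − π| = ‖ϑ − π‖_𝕋 ≤ η₀`
  obtain ⟨k, hk⟩ := exists_torusDist_eq_abs (ϑ - π)
  set ϑ' : ℝ := ϑ + k * (2 * π) with hϑ'def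
  have hϑ' : |ϑ' - π| ≤ η₀ := by rw [hϑ'def, show ϑ + k * (2 * π) - π = ϑ - π + k * (2 * π) by ring, ← hk]; exact hϑ
  have hperϑ : ∀ (x ψ : ℝ), levelPoint μ K x (ϑ + ψ) = levelPoint μ K x (ϑ' + ψ) := fun x ψ => by
    rw [hϑ'def, show ϑ + (k : ℝ) * (2 * π) + ψ = ϑ + ψ + 2 * π * (k : ℝ) by ring, levelPoint_add_int_mul_two_pi]
  have hfun : (fun ψ : ℝ => frameLevel μ K (levelPoint μ K 0 ψ + levelPoint μ K ρ (ϑ + ψ) - levelPoint μ K e (v + ψ))) =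
      fun ψ : ℝ => frameLevel μ K (levelPoint μ K 0 ψ + levelPoint μ K ρ (ϑ' + ψ) - levelPoint μ K e (v + ψ)) := by
    funext ψ; rw [hperϑ ρ ψ]
  have hS : pairSumPath μ K ρ ϑ θ 0 - levelPoint μ K e (v + θ) = levelPoint μ K 0 θ + levelPoint μ K ρ (ϑ' + θ) - levelPoint μ K e (v + θ) := by
    simp only [pairSumPath, add_zero]; rw [hperϑ ρ θ]
  rw [hfun, hS]
  -- §B the ratio control at `e = ρ = 0` for the representative `ϑ'`
  have hctrl : ∀ φ : ℝ, |deriv (fun ψ : ℝ => frameLevel μ K (levelPoint μ K 0 ψ + levelPoint μ K 0 (ϑ' + ψ) - levelPoint μ K 0 (φ + ψ))) θ| ≤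
      max (H₁₀ / (G / 2)) (H₀₀ / (G * δ₀ / 4)) * |frameLevel μ K (levelPoint μ K 0 θ + levelPoint μ K 0 (ϑ' + θ) - levelPoint μ K 0 (φ + θ))| :=
    fun φ => abs_baseDeriv_partnerBand_pp_le_mul_abs_cooper_zero hA hA20 hd hr hlo hhi hA₃ hA₄ hK₁ hK₂ hK₃ hG hδ₀ hδ₀π hδrow hη₀ hη₀row hϑ' θ φ
  -- §C the frame-derivative table and the radial rows (as in `…C4aKeyLemmaTangency`)
  have h𝒦K : ∀ i, 1 ≤ i → i ≤ 1 + 1 → ∀ p : Momentum, ‖iteratedFDeriv ℝ i (frameLevel μ K) p‖ ≤ 𝒦 := by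
    intro i hi1 hi p
    interval_cases i
    · rw [← norm_iteratedFDeriv_fderiv, iteratedFDeriv_zero_eq_comp, Function.comp_apply, LinearIsometryEquiv.norm_map]
      exact (hK₁ p).trans (le_max_left _ _)
    · exact (hK₂ p).trans (le_max_right _ _)
  set RR : ℕ → ℝ := fun i => if i = 0 then 1 / d else if i = 1 then RR₁ else
      if i = 2 then uRowTwoConst A A₃ d + 1 / d + 2 * (RR₁ - 1 / d) else uRowThreeConst A A₃ A₄ d + 3 * (RR₁ - 1 / d) + 3 * uRowTwoConst A A₃ d + 1 / d with hRRdef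
  have hRR0 : RR 0 = 1 / d := by simp [hRRdef]
  have hRR1' : RR 1 = RR₁ := by simp [hRRdef]
  have hrows : ∀ {x : ℝ}, |x| < r → ∀ i, i ≤ 3 → ∀ s, ‖iteratedDeriv i (levelPoint μ K x) s - iteratedDeriv i (levelPoint μ K 0) s‖ ≤ RR i * |x| :=
    fun hx => radialRows_le_three hA hA20 hd hr hlo hhi hA₃ hA₄ (RR := RR) (le_of_eq (by simp [hRRdef, hddef, hBdef])) (le_of_eq (by simp [hRRdef, hRR₁, hddef, hBdef]))
      (le_of_eq (by simp [hRRdef, hRR₁, hddef, hBdef])) (le_of_eq (by simp [hRRdef, hRR₁, hddef, hBdef])) hx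
  have hRRe : ∀ i, i ≤ 1 → ∀ s, ‖iteratedDeriv i (levelPoint μ K e) s - iteratedDeriv i (levelPoint μ K 0) s‖ ≤ RR i * |e| :=
    fun i hi s => hrows he i (by omega) s
  have hRRp : ∀ i, i ≤ 1 → ∀ s, ‖iteratedDeriv i (levelPoint μ K ρ) s - iteratedDeriv i (levelPoint μ K 0) s‖ ≤ RR i * |ρ| :=
    fun i hi s => hrows hρ i (by omega) s
  have hDerow : ∀ j, 1 ≤ j → j ≤ 1 → 3 * msD6 A₃ A₄ A₅ A₆ j + |e| * RR j ≤ De ^ j := by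
    intro j hj1 hj2
    obtain rfl : j = 1 := le_antisymm hj2 hj1
    rw [pow_one, msD6_eq_msD _ _ _ _ (by norm_num), hRR1']
    have : |e| * RR₁ ≤ r * RR₁ := mul_le_mul_of_nonneg_right he.le hRR₁0
    exact le_trans (by linarith only [this]) (le_max_right _ _)
  have hDprow : ∀ j, 1 ≤ j → j ≤ 1 → 3 * msD6 A₃ A₄ A₅ A₆ j + |ρ| * RR j ≤ De ^ j := by
    intro j hj1 hj2
    obtain rfl : j = 1 := le_antisymm hj2 hj1
    rw [pow_one, msD6_eq_msD _ _ _ _ (by norm_num), hRR1']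
    have : |ρ| * RR₁ ≤ r * RR₁ := mul_le_mul_of_nonneg_right hρ.le hRR₁0
    exact le_trans (by linarith only [this]) (le_max_right _ _)
  have hRerow : ∀ j, j ≤ 1 → RR j ≤ Re * De ^ j := by
    intro j hj
    interval_cases j
    · rw [hRR0, pow_zero, mul_one]; exact le_max_left _ _
    · rw [hRR1', pow_one]
      calc RR₁ ≤ Re := le_max_right _ _
        _ = Re * 1 := (mul_one _).symm
        _ ≤ Re * De := mul_le_mul_of_nonneg_left hDe1 hRe0
  -- §D displacement
  exact abs_baseDeriv_partnerBand_pp_le_of_ratio_displacement hA hA20 hd hr hlo hhi hA₃ hA₄ hA₅ hA₆ ϑ' θ hQ0 hctrl h𝒦K hρ he hRRe hRRp hDe0 hRe0 hDe0 hRe0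
    hDerow hRerow hDprow hRerow v

end Sizes

end Summit.HubbardSuperconductivity.HubbardSuperconductivity.Theorems.C4a

end
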